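import Summits.AtomisticToContinuum.FouriersLaw.Theses.LocalOhmBV
import Summits.AtomisticToContinuum.FouriersLaw.Theses.TransferKernelPositivity
import Summits.AtomisticToContinuum.FouriersLaw.Theorems.PuiseuxTransferLedgerTwoModeBulkReduction

/-!
# Stub `stub_boundedBackflow` of line `registered` (crux `LocalOhmBV.BVProfile`, item stmt-AtomisticToContinuum-12012)
# in its pure equilibrium (cut-bond) form

The registered stub `stub_boundedBackflow` asks, under weak-NESS uniqueness and along any steady-state family of the
pinned anharmonic chain, for a boundary-layer width `ℓ` and a constant `K` (independent of `N`) bounding the total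
UPHILL variation `Σ_{ℓ ≤ i, i+1+ℓ < N} (θ_N(i+1) − θ_N(i))⁺` of every kinetic-temperature response profile `θ_N`.
The tree identifies the profile at fixed `N` (`TwoModeBulk.Sketch.tendsto_profileValue`): for the `(N+1)`-site chain
the response limit at site `i` IS the cut-bond value `u_N(i) = (γ/T²)∫₀^∞ Y_i − 1/2`,
`Y_i(t) = Cov_{Gibbs_T}(p_0², K_t p_i²)` (`K_t = transitionKernel (N+1) T T t`, equilibrium kernels with both baths
at `T`). Hence (`stub_boundedBackflow_iff_cutBondBackflow`) the stub is EQUIVALENT to the same backflow bound for the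
explicit equilibrium profiles `u_N` — no NESS, no `δ → 0` limit, no uniqueness hypothesis and no family left in it:
(→) run the stub along a steady family chosen from `pinnedChain_exists_isSteadyState` (`exists_steadyFamily`) at the
proved uniqueness `NessUnique_holds`, with `θ := u_N`; (←) limits along `𝓝[≠] 0` are unique, so any admissible `θ`
IS `u_N` pointwise; `N = 0` sites: the sum is empty and `0 ≤ K` follows from the kernel form at one site (a sum of
positive parts). No definitions. [folklore]
-/

noncomputable section

open MeasureTheory Filter Topology Set

namespace Summit.AtomisticToContinuum.FouriersLaw.Theorems

open Literature.MathematicalPhysics.KineticTheory.HeatConduction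
open Summit.AtomisticToContinuum.FouriersLaw.Theorems.BoundaryKubo.Negative.LoadBearing (UniqueSteady SteadyFamily)
open Summit.AtomisticToContinuum.FouriersLaw.Theorems.TwoModeBulk.Sketch (tendsto_profileValue exists_steadyFamily)

/-- **The stub `stub_boundedBackflow` is EQUIVALENT to an `N`-uniform backflow bound for ONE explicit family of
equilibrium profiles** (lossless reduction). With
`u_N(i) = (γ/T²)∫₀^∞ Cov_{Gibbs_T}(p_0², K_t p_i²) dt − 1/2` for the `(N+1)`-site equilibrium chain: the stub holds iff
for all admissible parameters and `T > 0` there are `ℓ`, `K` with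
`Σ_i Σ_j [j = i+1 ∧ ℓ ≤ i ∧ i+1+ℓ < N+1] (u_N(j) − u_N(i))⁺ ≤ K` for every `N`. (→): the stub along a chosen steady
family (`exists_steadyFamily`) at `NessUnique_holds`, with `θ := u_N` (`tendsto_profileValue`). (←): every admissible
`θ` on `N + 1` sites equals `u_N` pointwise (`tendsto_nhds_unique`); on `0` sites the sum is empty and `0 ≤ K` by the
kernel form at `N = 0`. [folklore] -/
theorem stub_boundedBackflow_iff_cutBondBackflow : (∀ ω₂ lam β γ : ℝ, 0 < ω₂ → 0 < lam → 0 < β → 0 < γ → (∀ (N : ℕ) (T_L T_R : ℝ), 0 < T_L → 0 < T_R → ∀ μ ν : MeasureTheory.Measure (Literature.MathematicalPhysics.KineticTheory.HeatConduction.PhaseSpace N), (Literature.MathematicalPhysics.KineticTheory.HeatConduction.pinnedChain ω₂ lam β γ).IsSteadyState N T_L T_R μ → (Literature.MathematicalPhysics.KineticTheory.HeatConduction.pinnedChain ω₂ lam β γ).IsSteadyState N T_L T_R ν → μ = ν) → ∀ μ : (N : ℕ) → ℝ → ℝ → MeasureTheory.Measure (Literature.MathematicalPhysics.KineticTheory.HeatConduction.PhaseSpace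 N), (∀ (N : ℕ) (T_L T_R : ℝ), 0 < T_L → 0 < T_R → (Literature.MathematicalPhysics.KineticTheory.HeatConduction.pinnedChain ω₂ lam β γ).IsSteadyState N T_L T_R (μ N T_L T_R)) → ∀ T : ℝ, 0 < T → ∃ (ℓ : ℕ) (K : ℝ), ∀ (N : ℕ) (θ : Fin N → ℝ), (∀ i : Fin N, Filter.Tendsto (fun δ : ℝ => ((∫ x, (x.2 i) ^ 2 ∂(μ N (T + δ / 2) (T - δ / 2))) - ∫ x, (x.2 i) ^ 2 ∂(μ N T T)) / δ) (nhdsWithin 0 {(0 : ℝ)}ᶜ) (nhds (θ i))) → ∑ i : Fin N, ∑ j : Fin N, (if j.val = i.val + 1 ∧ ℓ ≤ i.val ∧ i.val + 1 + ℓ < N then max (θ j - θ i) 0 else 0) ≤ K) ↔ (∀ ω₂ lam β γ : ℝ, 0 < ω₂ → 0 < lam → 0 < β → 0 < γ → ∀ T : ℝ, 0 < T → ∃ (ℓ : ℕ) (K : ℝ), ∀ N : ℕ, ∑ i : Fin (N + 1), ∑ j : Fin (N + 1), (if j.val = i.val + 1 ∧ ℓ ≤ i.val ∧ i.val + 1 +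 ℓ < N + 1 then max ((γ / T ^ 2 * (∫ t in Set.Ioi (0 : ℝ), ((∫ z, (z.2 0) ^ 2 * (∫ y, (y.2 j) ^ 2 ∂((Literature.MathematicalPhysics.KineticTheory.HeatConduction.pinnedChain ω₂ lam β γ).transitionKernel (N + 1) T T t.toNNReal z)) ∂((Literature.MathematicalPhysics.KineticTheory.HeatConduction.pinnedChain ω₂ lam β γ).gibbsMeasure (N + 1) T)) - (∫ z, (z.2 0) ^ 2 ∂((Literature.MathematicalPhysics.KineticTheory.HeatConduction.pinnedChain ω₂ lam β γ).gibbsMeasure (N + 1) T)) * (∫ z, (∫ y, (y.2 j) ^ 2 ∂((Literature.MathematicalPhysics.KineticTheory.HeatConduction.pinnedChain ω₂ lam β γ).transitionKernel (N + 1) T T t.toNNReal z)) ∂((Literature.MathematicalPhysics.KineticTheory.HeatConduction.pinnedChain ω₂ lam β γ).gibbsMeasure (N + 1) T)))) - 1 / 2) - (γ / T ^ 2 * (∫ t in Set.Ioi (0 : ℝ), ((∫ z, (z.2 0) ^ 2 * (∫ y, (y.2 i) ^ 2 ∂((Literature.MathematicalPhysics.KineticTheory.HeatConduction.pinnedChain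 ω₂ lam β γ).transitionKernel (N + 1) T T t.toNNReal z)) ∂((Literature.MathematicalPhysics.KineticTheory.HeatConduction.pinnedChain ω₂ lam β γ).gibbsMeasure (N + 1) T)) - (∫ z, (z.2 0) ^ 2 ∂((Literature.MathematicalPhysics.KineticTheory.HeatConduction.pinnedChain ω₂ lam β γ).gibbsMeasure (N + 1) T)) * (∫ z, (∫ y, (y.2 i) ^ 2 ∂((Literature.MathematicalPhysics.KineticTheory.HeatConduction.pinnedChain ω₂ lam β γ).transitionKernel (N + 1) T T t.toNNReal z)) ∂((Literature.MathematicalPhysics.KineticTheory.HeatConduction.pinnedChain ω₂ lam β γ).gibbsMeasure (N + 1) T)))) - 1 / 2)) 0 else 0) ≤ K) := by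
  constructor
  · -- (→): the stub along a chosen steady family at the proved uniqueness, with `θ := u_N`
    intro h ω₂ lam β γ hω hl hβ hγ T hT
    have hU : UniqueSteady ω₂ lam β γ :=
      Summit.AtomisticToContinuum.FouriersLaw.Theses.TransferKernelPositivity.NessUnique_holds ω₂ lam β γ hω hl hβ hγ
    obtain ⟨μ, hμ⟩ := exists_steadyFamily hω hl hβ hγ
    obtain ⟨ℓ, K, hK⟩ := h ω₂ lam β γ hω hl hβ hγ hU μ hμ T hT
    exact ⟨ℓ, K, fun N => hK (N + 1) _ (fun i => tendsto_profileValue hω hl hβ hγ hU hμ hT N i)⟩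
  · -- (←): any admissible profile is the cut-bond profile pointwise
    intro h ω₂ lam β γ hω hl hβ hγ huniq μ hμ T hT
    have hU : UniqueSteady ω₂ lam β γ := huniq
    have hfam : SteadyFamily ω₂ lam β γ μ := hμ
    obtain ⟨ℓ, K, hK⟩ := h ω₂ lam β γ hω hl hβ hγ T hT
    refine ⟨ℓ, K, fun N θ hθ => ?_⟩
    cases N with
    | zero =>
      -- no sites: the sum is empty; `0 ≤ K` from the kernel form at one site (a sum of nonnegative terms)
      rw [Finset.sum_eq_zero (fun i _ => i.elim0)]
      refine le_trans ?_ (hK 0)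
      exact Finset.sum_nonneg fun i _ => Finset.sum_nonneg fun j _ => by
        split_ifs
        · exact le_max_right _ _
        · exact le_rfl
    | succ M =>
      have hθu : ∀ i : Fin (M + 1), θ i = γ / T ^ 2 * (∫ t in Set.Ioi (0 : ℝ),
          ((∫ z, (z.2 0) ^ 2 * (∫ y, (y.2 i) ^ 2
            ∂((pinnedChain ω₂ lam β γ).transitionKernel (M + 1) T T t.toNNReal z))
            ∂((pinnedChain ω₂ lam β γ).gibbsMeasure (M + 1) T)) -
          (∫ z, (z.2 0) ^ 2 ∂((pinnedChain ω₂ lam β γ).gibbsMeasure (M + 1) T)) *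
            (∫ z, (∫ y, (y.2 i) ^ 2
              ∂((pinnedChain ω₂ lam β γ).transitionKernel (M + 1) T T t.toNNReal z))
              ∂((pinnedChain ω₂ lam β γ).gibbsMeasure (M + 1) T)))) - 1 / 2 :=
        fun i => tendsto_nhds_unique (hθ i) (tendsto_profileValue hω hl hβ hγ hU hfam hT M i)
      have heq : (∑ i : Fin (M + 1), ∑ j : Fin (M + 1),
          (if j.val = i.val + 1 ∧ ℓ ≤ i.val ∧ i.val + 1 + ℓ < M + 1 then max (θ j - θ i) 0 else 0)) =
          ∑ i : Fin (M + 1), ∑ j : Fin (M + 1),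
            (if j.val = i.val + 1 ∧ ℓ ≤ i.val ∧ i.val + 1 + ℓ < M + 1 then
              max ((γ / T ^ 2 * (∫ t in Set.Ioi (0 : ℝ),
                ((∫ z, (z.2 0) ^ 2 * (∫ y, (y.2 j) ^ 2
                  ∂((pinnedChain ω₂ lam β γ).transitionKernel (M + 1) T T t.toNNReal z))
                  ∂((pinnedChain ω₂ lam β γ).gibbsMeasure (M + 1) T)) -
                (∫ z, (z.2 0) ^ 2 ∂((pinnedChain ω₂ lam β γ).gibbsMeasure (M + 1) T)) *
                  (∫ z, (∫ y, (y.2 j) ^ 2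
                    ∂((pinnedChain ω₂ lam β γ).transitionKernel (M + 1) T T t.toNNReal z))
                    ∂((pinnedChain ω₂ lam β γ).gibbsMeasure (M + 1) T)))) - 1 / 2) -
                (γ / T ^ 2 * (∫ t in Set.Ioi (0 : ℝ),
                ((∫ z, (z.2 0) ^ 2 * (∫ y, (y.2 i) ^ 2
                  ∂((pinnedChain ω₂ lam β γ).transitionKernel (M + 1) T T t.toNNReal z))
                  ∂((pinnedChain ω₂ lam β γ).gibbsMeasure (M + 1) T)) -
                (∫ z, (z.2 0) ^ 2 ∂((pinnedChain ω₂ lam β γ).gibbsMeasure (M + 1) T)) *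
                  (∫ z, (∫ y, (y.2 i) ^ 2
                    ∂((pinnedChain ω₂ lam β γ).transitionKernel (M + 1) T T t.toNNReal z))
                    ∂((pinnedChain ω₂ lam β γ).gibbsMeasure (M + 1) T)))) - 1 / 2)) 0
              else 0) := by
        refine Finset.sum_congr rfl fun i _ => Finset.sum_congr rfl fun j _ => ?_
        rw [hθu i, hθu j]
      rw [heq]
      exact hK M

end Summit.AtomisticToContinuum.FouriersLaw.Theorems

end
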